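import Summits.BirchSwinnertonDyer.Rank1Residual.X9.TransportSweepA
import HarnessLib

/-!
# Class X9, `p = 5`: the TRANSPORT SWEEP, part E — `BSD(E,5)` for 3 Tamagawa-obstructed `5S4` pairs (2 of analytic rank `0`, 1 of analytic rank `1`)
# by Greenberg–Vatsal transport from LEVEL-LOWERED (or prime-traded) congruent partners — per-pair kernel records, the partner's `BSD(A,5)` a displayed binder

HONEST FRAMING (cell `b2b-bsdres-*`, verbatim): the cell deletes COMBINATION-SHAPED residual classes of
the rank-≤1 BSD formula from PUBLISHED theorems only and TYPES the construction-shaped remainder; this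
is not "finishing BSD". Class X9 (good ordinary `p ≥ 5`, `ρ̄_{E,p}` irreducible and not surjective) stays
TYPED at class level; everything here is PER PAIR; no lane verdict is changed; no named fact is introduced;
nothing is booked by this unit (the lane books, the referee rules). Unit `b2b-bsdres-x9`, gen 16
(companion of `X9/TransportSweepA.lean`, whose §1 has the generic theorems and the full account).

## What this file does (our own work, hence `Summits/`)

As in part A: the
`p`-part of BSD PROPAGATES along mod-`p` congruences between curves of analytic rank `≤ 1` — C1 `A[p] ≅ E[p]` (finite by
Kraus–Oesterlé 1992 Prop. 4) + `BSD(A,p)` + C2 (a unit coefficient of `𝓛_MSD(A)`) + C3 (Schneider's certificate for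
whichever of `A`, `E` has analytic rank `1`) ⟹ Mazur's main conjecture for `(A,p)` with `μ = 0` (BCS 2025 Thm. 1.1.2 (a),
exponent forced to `0`) ⟹ the same for `(E,p)` (Greenberg–Vatsal 2000 Thm. (1.4)) ⟹ `BSD(E,p)` (rank `0`: Greenberg
Thm. 4.1 + interpolation + GZK; rank `1`: Perrin-Riou–Schneider + Perrin-Riou 1987 + GZK).


GEN 16's SWEEP (`HOME/b2b-bsdres-x9/X9-CENSUS-G16.md`, `g16/sweep/`):
after gen 15 exactly 66 X9 pairs (`N < 5·10⁵`, `r_an ≤ 1`; all `5S4`) had NO flag-free route — only the Jetchev–Cha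
index bound at a non-surjective prime (x9 fold `JETCHEV-CHA`; lane flag `JET@nonsurj` / `Miller11-Thm54-Cha-case`): one
multiplicative prime `ℓ` with `5 ∣ c_ℓ` inflates every Heegner index. At that prime `E[5]` is UNRAMIFIED (`5 ∣ v_ℓ(Δ)`),
so level lowering predicts a congruent newform of level `N_E/ℓ`; a screen of all `2 164 260` Cremona isogeny classes
(`cong_screen_g16.py`: conductor support + trace conditions at `ℓ ≤ 97`) finds a RATIONAL congruent partner below
`5·10⁵` for 32 of the 66 (29 level-lowered, `N_A ∣ N_E`; 3 congruent only to each other) and a USABLE one — analytic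
rank `≤ 1`, good ordinary at `5`, flag-free two-engine Heegner certificate (x9 fold CERT, `ord₅ [A(K):ℤy_K] = 0`) —
for 26 = the 4 T-JET cells of gen 15 + the 22 pairs of this sweep (parts A–H; 19 level-lowered, 3 with the extra
multiplicative prime traded `7 ↔ 3`). This part: `266616ck1 ← 38088z1`, `274428ba1 ← 39204j1`, `291312bv1 ← 41616ck1`.
Certificates of THIS unit (kit j130867; gen-15 kit `jobT` byte copies + `make_input_g16.py`): C1 by TWO engines (PARI
`ellap`; ENGINE D pure-Python BSGS/Mestre, self-test PASS) up to the Kraus–Oesterlé bound — 22/22 OK, identical prime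
counts; C3 by TWO engines (PARI `ellpadicheight`; pure-Python Mazur–Tate σ engine) for every rank-`1` target and partner,
all finite; C2 = gen 9's two-engine `μ(𝓛₅) = 0` table `g9/mu/MU-ALL.tsv` (790/790 X9 pairs; every partner is an X9 pair).
In the kernel these stay BINDERS (`hcong`, `hcertA`, `hSchA`, `hC3`).

References: Greenberg–Vatsal, Invent. Math. 142 (2000) Thm. (1.4); Burungale–Castella–Skinner, IMRN 2025
Thm. 1.1.2 (a); Kraus–Oesterlé, Math. Ann. 293 (1992) Prop. 4; Greenberg, LNM 1716 (1999) Thm. 4.1;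
Perrin-Riou 1987 §1.4; Balakrishnan–Müller–Stein 2016 Thm. 1.7 (Schneider); Mazur 1978 Prop. 6.3 (1);
Ribet 1990 (level lowering; motivation only); Miller 2011 Thm. 1.2 / Def. 1.1; Silverman AEC VII.1; Cremona's tables.
-/

set_option autoImplicit false

noncomputable section

open scoped Classical MatrixGroups ModularForm

open CongruenceSubgroup WeierstrassCurve Literature.NumberTheory.EllipticCurves
  Literature.NumberTheory.EllipticCurves.ModularForms Literature.NumberTheory.EllipticCurves.Rank1Residual
  Literature.NumberTheory.EllipticCurves.Rank1Residual.Typed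
  Literature.NumberTheory.EllipticCurves.Rank1Residual.X11RankOneCertificates
  Summit.BirchSwinnertonDyer.BirchSwinnertonDyer.Rank1Residual.IntModel
  Summit.BirchSwinnertonDyer.BirchSwinnertonDyer.Rank1Residual.X11RankOne
  Summit.BirchSwinnertonDyer.Rank1Residual.X11b

namespace Summit.BirchSwinnertonDyer.Rank1Residual.X9
/-! ### §1. Frobenius point counts (kernel-decided data) -/

/-- `#Ẽ(𝔽₅) = 3` (`a₅ = 3`: good ORDINARY) for Cremona's model `266616ck1` (kernel count). [folklore] -/
theorem card_t266616ck1_5 :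
    Nat.card (((⟨0, 0, 0, -17526, -859763⟩ : WeierstrassCurve ℤ).map
      (Int.castRingHom (ZMod 5))).toAffine.Point) = 3 := by
  rw [@WeierstrassCurve.natCard_point_eq_one_add_card (ZMod 5) (@ZMod.instField 5 ⟨by norm_num⟩) _ _ _
    (by decide +kernel), @card_sol_eq_sum_euler (ZMod 5) (@ZMod.instField 5 ⟨by norm_num⟩) _ _
    (by rw [ZMod.ringChar_zmod_n]; decide), ZMod.card]
  decide +kernel

/-- `#Ẽ(𝔽₁₁) = 8` (`a₁₁ = 4`; `X² − a₁₁X + 11` root-free mod `5`) for Cremona's model `266616ck1` (kernel count). [folklore] -/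
theorem card_t266616ck1_11 :
    Nat.card (((⟨0, 0, 0, -17526, -859763⟩ : WeierstrassCurve ℤ).map
      (Int.castRingHom (ZMod 11))).toAffine.Point) = 8 := by
  rw [@WeierstrassCurve.natCard_point_eq_one_add_card (ZMod 11) (@ZMod.instField 11 ⟨by norm_num⟩) _ _ _
    (by decide +kernel), @card_sol_eq_sum_euler (ZMod 11) (@ZMod.instField 11 ⟨by norm_num⟩) _ _
    (by rw [ZMod.ringChar_zmod_n]; decide), ZMod.card]
  decide +kernel

/-- `#Ã(𝔽₅) = 8` (`a₅ = -2`: good ORDINARY) for Cremona's model `38088z1` (kernel count). [folklore] -/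
theorem card_s38088z1_5 :
    Nat.card (((⟨0, 0, 0, 69, 1334⟩ : WeierstrassCurve ℤ).map
      (Int.castRingHom (ZMod 5))).toAffine.Point) = 8 := by
  rw [@WeierstrassCurve.natCard_point_eq_one_add_card (ZMod 5) (@ZMod.instField 5 ⟨by norm_num⟩) _ _ _
    (by decide +kernel), @card_sol_eq_sum_euler (ZMod 5) (@ZMod.instField 5 ⟨by norm_num⟩) _ _
    (by rw [ZMod.ringChar_zmod_n]; decide), ZMod.card]
  decide +kernel

/-- `#Ẽ(𝔽₅) = 4` (`a₅ = 2`: good ORDINARY) for Cremona's model `274428ba1` (kernel count). [folklore] -/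
theorem card_t274428ba1_5 :
    Nat.card (((⟨0, 0, 0, -15609, 807917⟩ : WeierstrassCurve ℤ).map
      (Int.castRingHom (ZMod 5))).toAffine.Point) = 4 := by
  rw [@WeierstrassCurve.natCard_point_eq_one_add_card (ZMod 5) (@ZMod.instField 5 ⟨by norm_num⟩) _ _ _
    (by decide +kernel), @card_sol_eq_sum_euler (ZMod 5) (@ZMod.instField 5 ⟨by norm_num⟩) _ _
    (by rw [ZMod.ringChar_zmod_n]; decide), ZMod.card]
  decide +kernel

/-- `#Ẽ(𝔽₁₃) = 14` (`a₁₃ = 0`; `X² − a₁₃X + 13` root-free mod `5`) for Cremona's model `274428ba1` (kernel count). [folklore] -/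
theorem card_t274428ba1_13 :
    Nat.card (((⟨0, 0, 0, -15609, 807917⟩ : WeierstrassCurve ℤ).map
      (Int.castRingHom (ZMod 13))).toAffine.Point) = 14 := by
  rw [@WeierstrassCurve.natCard_point_eq_one_add_card (ZMod 13) (@ZMod.instField 13 ⟨by norm_num⟩) _ _ _
    (by decide +kernel), @card_sol_eq_sum_euler (ZMod 13) (@ZMod.instField 13 ⟨by norm_num⟩) _ _
    (by rw [ZMod.ringChar_zmod_n]; decide), ZMod.card]
  decide +kernel

/-- `#Ã(𝔽₅) = 9` (`a₅ = -3`: good ORDINARY) for Cremona's model `39204j1` (kernel count). [folklore] -/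
theorem card_s39204j1_5 :
    Nat.card (((⟨0, 0, 0, -4719, -125114⟩ : WeierstrassCurve ℤ).map
      (Int.castRingHom (ZMod 5))).toAffine.Point) = 9 := by
  rw [@WeierstrassCurve.natCard_point_eq_one_add_card (ZMod 5) (@ZMod.instField 5 ⟨by norm_num⟩) _ _ _
    (by decide +kernel), @card_sol_eq_sum_euler (ZMod 5) (@ZMod.instField 5 ⟨by norm_num⟩) _ _
    (by rw [ZMod.ringChar_zmod_n]; decide), ZMod.card]
  decide +kernel

/-- `#Ẽ(𝔽₅) = 8` (`a₅ = -2`: good ORDINARY) for Cremona's model `291312bv1` (kernel count). [folklore] -/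
theorem card_t291312bv1_5 :
    Nat.card (((⟨0, 0, 0, -9270831, 10169015834⟩ : WeierstrassCurve ℤ).map
      (Int.castRingHom (ZMod 5))).toAffine.Point) = 8 := by
  rw [@WeierstrassCurve.natCard_point_eq_one_add_card (ZMod 5) (@ZMod.instField 5 ⟨by norm_num⟩) _ _ _
    (by decide +kernel), @card_sol_eq_sum_euler (ZMod 5) (@ZMod.instField 5 ⟨by norm_num⟩) _ _
    (by rw [ZMod.ringChar_zmod_n]; decide), ZMod.card]
  decide +kernel

/-- `#Ẽ(𝔽₁₁) = 8` (`a₁₁ = 4`; `X² − a₁₁X + 11` root-free mod `5`) for Cremona's model `291312bv1` (kernel count). [folklore] -/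
theorem card_t291312bv1_11 :
    Nat.card (((⟨0, 0, 0, -9270831, 10169015834⟩ : WeierstrassCurve ℤ).map
      (Int.castRingHom (ZMod 11))).toAffine.Point) = 8 := by
  rw [@WeierstrassCurve.natCard_point_eq_one_add_card (ZMod 11) (@ZMod.instField 11 ⟨by norm_num⟩) _ _ _
    (by decide +kernel), @card_sol_eq_sum_euler (ZMod 11) (@ZMod.instField 11 ⟨by norm_num⟩) _ _
    (by rw [ZMod.ringChar_zmod_n]; decide), ZMod.card]
  decide +kernel

/-- `#Ã(𝔽₅) = 8` (`a₅ = -2`: good ORDINARY) for Cremona's model `41616ck1` (kernel count). [folklore] -/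
theorem card_s41616ck1_5 :
    Nat.card (((⟨0, 0, 0, 204, 799⟩ : WeierstrassCurve ℤ).map
      (Int.castRingHom (ZMod 5))).toAffine.Point) = 8 := by
  rw [@WeierstrassCurve.natCard_point_eq_one_add_card (ZMod 5) (@ZMod.instField 5 ⟨by norm_num⟩) _ _ _
    (by decide +kernel), @card_sol_eq_sum_euler (ZMod 5) (@ZMod.instField 5 ⟨by norm_num⟩) _ _
    (by rw [ZMod.ringChar_zmod_n]; decide), ZMod.card]
  decide +kernel

/-! ### §2. Ellipticity and global minimality of the literal models (kernel) -/

/-- `266616ck1`'s Cremona model is an elliptic curve (`Δ ≠ 0`, kernel). [cite: Cremona2006, Table 1 (Cremona label 266616ck1)] -/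
theorem isElliptic_t266616ck1 : (⟨0, 0, 0, -17526, -859763⟩ : WeierstrassCurve ℚ).IsElliptic :=
  isElliptic_of_discOf_ne_zero 0 0 0 (-17526) (-859763) (by decide +kernel)

/-- `266616ck1`'s Cremona model is globally minimal (Kraus' bounded criterion, kernel). [cite: SilvermanAEC2009, VII.1 Remark 1.1] -/
theorem isGloballyMinimal_t266616ck1 : (⟨0, 0, 0, -17526, -859763⟩ : WeierstrassCurve ℚ).IsGloballyMinimal :=
  isGloballyMinimal_of_krausCriterion_bounded₂ 0 0 0 (-17526) (-859763) (by decide +kernel) (by decide +kernel)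
    (by decide +kernel)

/-- `38088z1`'s Cremona model is an elliptic curve (`Δ ≠ 0`, kernel). [cite: Cremona2006, Table 1 (Cremona label 38088z1)] -/
theorem isElliptic_s38088z1 : (⟨0, 0, 0, 69, 1334⟩ : WeierstrassCurve ℚ).IsElliptic :=
  isElliptic_of_discOf_ne_zero 0 0 0 69 1334 (by decide +kernel)

/-- `38088z1`'s Cremona model is globally minimal (Kraus' bounded criterion, kernel). [cite: SilvermanAEC2009, VII.1 Remark 1.1] -/
theorem isGloballyMinimal_s38088z1 : (⟨0, 0, 0, 69, 1334⟩ : WeierstrassCurve ℚ).IsGloballyMinimal :=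
  isGloballyMinimal_of_krausCriterion_bounded₂ 0 0 0 69 1334 (by decide +kernel) (by decide +kernel)
    (by decide +kernel)

/-- `274428ba1`'s Cremona model is an elliptic curve (`Δ ≠ 0`, kernel). [cite: Cremona2006, Table 1 (Cremona label 274428ba1)] -/
theorem isElliptic_t274428ba1 : (⟨0, 0, 0, -15609, 807917⟩ : WeierstrassCurve ℚ).IsElliptic :=
  isElliptic_of_discOf_ne_zero 0 0 0 (-15609) 807917 (by decide +kernel)

/-- `274428ba1`'s Cremona model is globally minimal (Kraus' bounded criterion, kernel). [cite: SilvermanAEC2009, VII.1 Remark 1.1] -/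
theorem isGloballyMinimal_t274428ba1 : (⟨0, 0, 0, -15609, 807917⟩ : WeierstrassCurve ℚ).IsGloballyMinimal :=
  isGloballyMinimal_of_krausCriterion_bounded₂ 0 0 0 (-15609) 807917 (by decide +kernel) (by decide +kernel)
    (by decide +kernel)

/-- `39204j1`'s Cremona model is an elliptic curve (`Δ ≠ 0`, kernel). [cite: Cremona2006, Table 1 (Cremona label 39204j1)] -/
theorem isElliptic_s39204j1 : (⟨0, 0, 0, -4719, -125114⟩ : WeierstrassCurve ℚ).IsElliptic :=
  isElliptic_of_discOf_ne_zero 0 0 0 (-4719) (-125114) (by decide +kernel)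

/-- `39204j1`'s Cremona model is globally minimal (Kraus' bounded criterion, kernel). [cite: SilvermanAEC2009, VII.1 Remark 1.1] -/
theorem isGloballyMinimal_s39204j1 : (⟨0, 0, 0, -4719, -125114⟩ : WeierstrassCurve ℚ).IsGloballyMinimal :=
  isGloballyMinimal_of_krausCriterion_bounded₂ 0 0 0 (-4719) (-125114) (by decide +kernel) (by decide +kernel)
    (by decide +kernel)

/-- `291312bv1`'s Cremona model is an elliptic curve (`Δ ≠ 0`, kernel). [cite: Cremona2006, Table 1 (Cremona label 291312bv1)] -/
theorem isElliptic_t291312bv1 : (⟨0, 0, 0, -9270831, 10169015834⟩ : WeierstrassCurve ℚ).IsElliptic :=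
  isElliptic_of_discOf_ne_zero 0 0 0 (-9270831) 10169015834 (by decide +kernel)

/-- `291312bv1`'s Cremona model is globally minimal (Kraus' bounded criterion, kernel). [cite: SilvermanAEC2009, VII.1 Remark 1.1] -/
theorem isGloballyMinimal_t291312bv1 : (⟨0, 0, 0, -9270831, 10169015834⟩ : WeierstrassCurve ℚ).IsGloballyMinimal :=
  isGloballyMinimal_of_krausCriterion_bounded₂ 0 0 0 (-9270831) 10169015834 (by decide +kernel) (by decide +kernel)
    (by decide +kernel)

/-- `41616ck1`'s Cremona model is an elliptic curve (`Δ ≠ 0`, kernel). [cite: Cremona2006, Table 1 (Cremona label 41616ck1)] -/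
theorem isElliptic_s41616ck1 : (⟨0, 0, 0, 204, 799⟩ : WeierstrassCurve ℚ).IsElliptic :=
  isElliptic_of_discOf_ne_zero 0 0 0 204 799 (by decide +kernel)

/-- `41616ck1`'s Cremona model is globally minimal (Kraus' bounded criterion, kernel). [cite: SilvermanAEC2009, VII.1 Remark 1.1] -/
theorem isGloballyMinimal_s41616ck1 : (⟨0, 0, 0, 204, 799⟩ : WeierstrassCurve ℚ).IsGloballyMinimal :=
  isGloballyMinimal_of_krausCriterion_bounded₂ 0 0 0 204 799 (by decide +kernel) (by decide +kernel)
    (by decide +kernel)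

/-! ### §3. The records -/

/-- **`BSD(E,5)` for `266616ck1`** (`N = 266616 = 2³·3²·7·23²`; good ORDINARY at `5`, `a₅ = 3`; Cremona model `[0, 0,
0, -17526, -859763]`; `ρ̄_{E,5}` irreducible (Frobenius witness `ℓ = 11`: `#Ẽ(𝔽₁₁) = 8`, `a₁₁ = 4`) and — census datum
— of EXCEPTIONAL type `5S4`; analytic rank `1`; `#Ш_an = 1`; `∏c_ℓ = 40` (`ord₅ ∏c_ℓ ≥ 1`: Tamagawa-obstructed Heegner
index); route of record: the Jetchev–Cha index bound ONLY (x9 fold `JETCHEV-CHA`: `D = -383`, `m = 160`, `ord₅ m = 1`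
= the Tamagawa valuation; flag `Miller11-Thm54-Cha-case` / lane `JET@nonsurj`; its `5`-descent line is [GRH] only)) —
**from the mod-`5` CONGRUENT LEVEL-LOWERED partner `38088z1`** (`N_A = 38088 = 2³·3²·23²` divides `N_E`: `E[5]` is
unramified at the extra multiplicative prime `ℓ = 7` of `E`, where `5 ∣ c_ℓ = v_ℓ(Δ)`; `5S4`, `a₅(A) = -2`, `r_an(A) =
0`, `#Ш_an(A) = 1`, `∏c_ℓ(A) = 1`; Heegner route of record CERT `D = -143`, `m = 4`, `ord₅ m = 0`, two engines (x9
fold), unflagged) by Greenberg–Vatsal transport (`bsdp_of_ainvs_of_bsdpPartner_of_congruences_of_analyticRank_le_one`: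
`BSDp A 5` (`hbsdA`, the binder the partner's certificate discharges)) + C2 + C3 ⟹ Mazur's main conjecture for `(A,5)`
with `μ = 0` ⟹ the same for `(E,5)` along `A[5] ≅ E[5]` ⟹ `BSD(E,5)`; in rank `1` of the target the last step is the
rank-one leading-term comparison (Perrin-Riou–Schneider, Perrin-Riou 1987) with `hC3`. Kernel-decided: `Δ ≠ 0` and
minimality of both models (`isElliptic_*`, `isGloballyMinimal_*` discharge the instance binders), `#Ẽ(𝔽₅) = 3`,
`#Ã(𝔽₅) = 8`, `E[5]` irreducible. Certificates (unit `b2b-bsdres-x9` gen 16, kit j130867;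
`HOME/b2b-bsdres-x9/g16/sweep/`): C1 = `hcong` with `M = 266 616` (`S = ∅`), `μ(M) = 635 904`, bound `B = 105 983`:
all `10 102` primes `ℓ ≤ B` with `v_ℓ(N_E N_A) ≤ 1` checked, `0` exceptions, TWO engines (PARI `ellap` via cypari2;
ENGINE D pure-Python BSGS/Mestre, identical count, `0` fallbacks); C2 = `hcertA` (`μ(𝓛₅(A)) = 0`: gen 9 `MU-ALL.tsv`,
engines B and C, `λ = 0`); `hSchA` vacuous (`r_an(A) = 0`); C3 for the target = `hC3` (PARI `ellpadicheight`
`[v(f),v(g)] = [1,2]`, `v₅(s₂) = 0`, `v₅(f − s₂g) = 1` + Mazur–Tate σ engine `v₅(h) = 0` (kit j130867); both finite ⇒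
the cyclotomic `5`-adic height of `E`'s Cremona generator is non-zero). Binders otherwise PUBLISHED (`hKO` … `hGZK`);
FINITE `r_an(E) ≤ 1`, `r_an(A) ≤ 1`. Per pair; nothing booked; no Jetchev, no descent of the target, no GRH.
[cite: GreenbergVatsal2000, Thm. (1.4) (arXiv p. 5)] [cite: KrausOesterle1992, Prop. 4] [cite: Miller2011LMS, Def. 1.1]
[cite: Cremona2006, Table 1 (Cremona labels 266616ck1, 38088z1)] -/
theorem bsdp_t266616ck1_of_bsdp_s38088z1
    (hKO : KrausOesterle1992.prop4_torsionIso_of_congruences)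
    (hBCS : burungale_castella_skinner_charIdeal_eq_padicLFunction)
    (hGr : greenberg_charValue_rankZero) (h5 : realPeriodRat_eq_unit_mul_plusPeriod)
    (hGV : GreenbergVatsal2000.thm14_mainConjecture_transfer_of_torsionIso)
    (hS : Schneider1985_order_charGenerator) (hPR : perrinRiou_rankOne_leadingTerms)
    (hmodP : nonempty_modularParametrizationData) (hmodL : hasEntireLFunction_rat)
    (hGZK : rank_eq_analyticRank_of_analyticRank_le_one)
    (W A : WeierstrassCurve ℚ) [W.IsElliptic] [W.IsGloballyMinimal] [A.IsElliptic] [A.IsGloballyMinimal]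
    [Fact (Nat.Prime 5)]
    (hW : W = ⟨0, 0, 0, -17526, -859763⟩) (hA : A = ⟨0, 0, 0, 69, 1334⟩)
    (hran : W.analyticRank ≤ 1) (hrA : A.analyticRank ≤ 1) (hbsdA : BSDp A 5)
    (hSchA : A.analyticRank = 1 → ∀ Dh : PAdicHeightData A 5, Dh.IsCanonical → SchneiderConjecture Dh)
    (hcertA : ∀ [NeZero (A.conductorNorm ℤ)] (fA : CuspForm (Gamma0 (A.conductorNorm ℤ)) 2),
        IsNewformOf A fA → ∀ (ϖ : ℚ), (ϖ : ℝ) * A.realPeriodRat = plusPeriod fA →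
      ∃ n : ℕ, ‖PowerSeries.coeff n
        (PowerSeries.C (ϖ : ℚ_[5]) * padicLFunction fA (unitRoot A 5 : ℚ_[5]))‖ = 1)
    (hcong : ∀ (ℓ : ℕ) [Fact ℓ.Prime],
      6 * ℓ < KrausOesterle1992.gammaZeroIndex (KrausOesterle1992.modulus W A) →
      (padicValNat ℓ (W.conductorNorm ℤ * A.conductorNorm ℤ) = 0 →
          (5 : ℤ) ∣ W.frobeniusTrace ℓ - A.frobeniusTrace ℓ) ∧
        (padicValNat ℓ (W.conductorNorm ℤ * A.conductorNorm ℤ) = 1 →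
          (5 : ℤ) ∣ W.frobeniusTrace ℓ * A.frobeniusTrace ℓ - (ℓ + 1)))
    (hC3 : W.analyticRank = 1 → ∀ Dh : PAdicHeightData W 5, Dh.IsCanonical → SchneiderConjecture Dh) :
    BSDp W 5 := by
  have hIW : integralModelInt W = ⟨0, 0, 0, -17526, -859763⟩ :=
    integralModelInt_eq_of_map_eq _ (by rw [hW]; ext <;> simp [WeierstrassCurve.map])
  have hIA : integralModelInt A = ⟨0, 0, 0, 69, 1334⟩ :=
    integralModelInt_eq_of_map_eq _ (by rw [hA]; ext <;> simp [WeierstrassCurve.map])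
  haveI : Fact (Nat.Prime 11) := ⟨by norm_num⟩
  exact bsdp_of_ainvs_of_bsdpPartner_of_congruences_of_analyticRank_le_one hKO hBCS hGr h5 hGV hS hPR hmodP hmodL hGZK
    0 0 0 (-17526) (-859763) hIW
    0 0 0 69 1334 hIA
    5 11 8 3 8 (by norm_num) (by decide +kernel) card_t266616ck1_5 (by decide) (by decide)
    (by decide +kernel) card_t266616ck1_11 (by decide) (by decide +kernel) card_s38088z1_5 (by decide)
    hran hrA hbsdA hSchA hcertA hcong hC3

/-- **`BSD(E,5)` for `274428ba1`** (`N = 274428 = 2²·3⁴·7·11²`; good ORDINARY at `5`, `a₅ = 2`; Cremona model `[0, 0,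
0, -15609, 807917]`; `ρ̄_{E,5}` irreducible (Frobenius witness `ℓ = 13`: `#Ẽ(𝔽₁₃) = 14`, `a₁₃ = 0`) and — census datum
— of EXCEPTIONAL type `5S4`; analytic rank `0`; `#Ш_an = 1`; `∏c_ℓ = 5` (`ord₅ ∏c_ℓ ≥ 1`: Tamagawa-obstructed Heegner
index); route of record: the Jetchev–Cha index bound ONLY (x9 fold `JETCHEV-CHA`: `D = -503`, `m = 10`, `ord₅ m = 1` =
the Tamagawa valuation; flag `Miller11-Thm54-Cha-case` / lane `JET@nonsurj`; its `5`-descent line is [GRH] only)) —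
**from the mod-`5` CONGRUENT LEVEL-LOWERED partner `39204j1`** (`N_A = 39204 = 2²·3⁴·11²` divides `N_E`: `E[5]` is
unramified at the extra multiplicative prime `ℓ = 7` of `E`, where `5 ∣ c_ℓ = v_ℓ(Δ)`; `5S4`, `a₅(A) = -3`, `r_an(A) =
1`, `#Ш_an(A) = 1`, `∏c_ℓ(A) = 2`; Heegner route of record CERT `D = -167`, `m = 4`, `ord₅ m = 0`, two engines (x9
fold), unflagged) by Greenberg–Vatsal transport (`bsdp_of_ainvs_of_bsdpPartner_of_congruences_of_analyticRank_le_one`: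
`BSDp A 5` (`hbsdA`, the binder the partner's certificate discharges)) + C2 + C3 ⟹ Mazur's main conjecture for `(A,5)`
with `μ = 0` ⟹ the same for `(E,5)` along `A[5] ≅ E[5]` ⟹ `BSD(E,5)`. Kernel-decided: `Δ ≠ 0` and minimality of both
models (`isElliptic_*`, `isGloballyMinimal_*` discharge the instance binders), `#Ẽ(𝔽₅) = 4`, `#Ã(𝔽₅) = 9`, `E[5]`
irreducible. Certificates (unit `b2b-bsdres-x9` gen 16, kit j130867; `HOME/b2b-bsdres-x9/g16/sweep/`): C1 = `hcong`
with `M = 274 428` (`S = ∅`), `μ(M) = 684 288`, bound `B = 114 047`: all `10 791` primes `ℓ ≤ B` with `v_ℓ(N_E N_A) ≤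
1` checked, `0` exceptions, TWO engines (PARI `ellap` via cypari2; ENGINE D pure-Python BSGS/Mestre, identical count,
`0` fallbacks); C2 = `hcertA` (`μ(𝓛₅(A)) = 0`: gen 9 `MU-ALL.tsv`, engines B and C, `λ = 1`; the certified unit
coefficient is not the constant term); C3 for the partner = `hSchA` (PARI `ellpadicheight` `[v(f),v(g)] = [1,2]`,
`v₅(s₂) = 0`, `v₅(f − s₂g) = 1` + Mazur–Tate σ engine `v₅(h) = 0` (kit j130867); both finite ⇒ the cyclotomic `5`-adic
height of `A`'s Cremona generator is non-zero); `hC3` vacuous (`r_an(E) = 0`). Binders otherwise PUBLISHED (`hKO` …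
`hGZK`); FINITE `r_an(E) ≤ 1`, `r_an(A) ≤ 1`. Per pair; nothing booked; no Jetchev, no descent of the target, no GRH.
[cite: GreenbergVatsal2000, Thm. (1.4) (arXiv p. 5)] [cite: KrausOesterle1992, Prop. 4] [cite: Miller2011LMS, Def. 1.1]
[cite: Cremona2006, Table 1 (Cremona labels 274428ba1, 39204j1)] -/
theorem bsdp_t274428ba1_of_bsdp_s39204j1
    (hKO : KrausOesterle1992.prop4_torsionIso_of_congruences)
    (hBCS : burungale_castella_skinner_charIdeal_eq_padicLFunction)
    (hGr : greenberg_charValue_rankZero) (h5 : realPeriodRat_eq_unit_mul_plusPeriod)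
    (hGV : GreenbergVatsal2000.thm14_mainConjecture_transfer_of_torsionIso)
    (hS : Schneider1985_order_charGenerator) (hPR : perrinRiou_rankOne_leadingTerms)
    (hmodP : nonempty_modularParametrizationData) (hmodL : hasEntireLFunction_rat)
    (hGZK : rank_eq_analyticRank_of_analyticRank_le_one)
    (W A : WeierstrassCurve ℚ) [W.IsElliptic] [W.IsGloballyMinimal] [A.IsElliptic] [A.IsGloballyMinimal]
    [Fact (Nat.Prime 5)]
    (hW : W = ⟨0, 0, 0, -15609, 807917⟩) (hA : A = ⟨0, 0, 0, -4719, -125114⟩)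
    (hran : W.analyticRank ≤ 1) (hrA : A.analyticRank ≤ 1) (hbsdA : BSDp A 5)
    (hSchA : A.analyticRank = 1 → ∀ Dh : PAdicHeightData A 5, Dh.IsCanonical → SchneiderConjecture Dh)
    (hcertA : ∀ [NeZero (A.conductorNorm ℤ)] (fA : CuspForm (Gamma0 (A.conductorNorm ℤ)) 2),
        IsNewformOf A fA → ∀ (ϖ : ℚ), (ϖ : ℝ) * A.realPeriodRat = plusPeriod fA →
      ∃ n : ℕ, ‖PowerSeries.coeff n
        (PowerSeries.C (ϖ : ℚ_[5]) * padicLFunction fA (unitRoot A 5 : ℚ_[5]))‖ = 1)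
    (hcong : ∀ (ℓ : ℕ) [Fact ℓ.Prime],
      6 * ℓ < KrausOesterle1992.gammaZeroIndex (KrausOesterle1992.modulus W A) →
      (padicValNat ℓ (W.conductorNorm ℤ * A.conductorNorm ℤ) = 0 →
          (5 : ℤ) ∣ W.frobeniusTrace ℓ - A.frobeniusTrace ℓ) ∧
        (padicValNat ℓ (W.conductorNorm ℤ * A.conductorNorm ℤ) = 1 →
          (5 : ℤ) ∣ W.frobeniusTrace ℓ * A.frobeniusTrace ℓ - (ℓ + 1)))
    (hC3 : W.analyticRank = 1 → ∀ Dh : PAdicHeightData W 5, Dh.IsCanonical → SchneiderConjecture Dh) :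
    BSDp W 5 := by
  have hIW : integralModelInt W = ⟨0, 0, 0, -15609, 807917⟩ :=
    integralModelInt_eq_of_map_eq _ (by rw [hW]; ext <;> simp [WeierstrassCurve.map])
  have hIA : integralModelInt A = ⟨0, 0, 0, -4719, -125114⟩ :=
    integralModelInt_eq_of_map_eq _ (by rw [hA]; ext <;> simp [WeierstrassCurve.map])
  haveI : Fact (Nat.Prime 13) := ⟨by norm_num⟩
  exact bsdp_of_ainvs_of_bsdpPartner_of_congruences_of_analyticRank_le_one hKO hBCS hGr h5 hGV hS hPR hmodP hmodL hGZK
    0 0 0 (-15609) 807917 hIW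
    0 0 0 (-4719) (-125114) hIA
    5 13 14 4 9 (by norm_num) (by decide +kernel) card_t274428ba1_5 (by decide) (by decide)
    (by decide +kernel) card_t274428ba1_13 (by decide) (by decide +kernel) card_s39204j1_5 (by decide)
    hran hrA hbsdA hSchA hcertA hcong hC3

/-- **`BSD(E,5)` for `291312bv1`** (`N = 291312 = 2⁴·3²·7·17²`; good ORDINARY at `5`, `a₅ = -2`; Cremona model `[0, 0,
0, -9270831, 10169015834]`; `ρ̄_{E,5}` irreducible (Frobenius witness `ℓ = 11`: `#Ẽ(𝔽₁₁) = 8`, `a₁₁ = 4`) and — census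
datum — of EXCEPTIONAL type `5S4`; analytic rank `0`; `#Ш_an = 4`; `∏c_ℓ = 5` (`ord₅ ∏c_ℓ ≥ 1`: Tamagawa-obstructed
Heegner index); route of record: the Jetchev–Cha index bound ONLY (x9 fold `JETCHEV-CHA`: `D = -47`, `m = 20`, `ord₅ m
= 1` = the Tamagawa valuation; flag `Miller11-Thm54-Cha-case` / lane `JET@nonsurj`; its `5`-descent line is [GRH]
only)) — **from the mod-`5` CONGRUENT LEVEL-LOWERED partner `41616ck1`** (`N_A = 41616 = 2⁴·3²·17²` divides `N_E`:
`E[5]` is unramified at the extra multiplicative prime `ℓ = 7` of `E`, where `5 ∣ c_ℓ = v_ℓ(Δ)`; `5S4`, `a₅(A) = -2`,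
`r_an(A) = 1`, `#Ш_an(A) = 1`, `∏c_ℓ(A) = 2`; Heegner route of record CERT `D = -47`, `m = 8`, `ord₅ m = 0`, two
engines (x9 fold), unflagged) by Greenberg–Vatsal transport
(`bsdp_of_ainvs_of_bsdpPartner_of_congruences_of_analyticRank_le_one`: `BSDp A 5` (`hbsdA`, the binder the partner's
certificate discharges)) + C2 + C3 ⟹ Mazur's main conjecture for `(A,5)` with `μ = 0` ⟹ the same for `(E,5)` along
`A[5] ≅ E[5]` ⟹ `BSD(E,5)`. Kernel-decided: `Δ ≠ 0` and minimality of both models (`isElliptic_*`,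
`isGloballyMinimal_*` discharge the instance binders), `#Ẽ(𝔽₅) = 8`, `#Ã(𝔽₅) = 8`, `E[5]` irreducible. Certificates
(unit `b2b-bsdres-x9` gen 16, kit j130867; `HOME/b2b-bsdres-x9/g16/sweep/`): C1 = `hcong` with `M = 291 312` (`S =
∅`), `μ(M) = 705 024`, bound `B = 117 503`: all `11 084` primes `ℓ ≤ B` with `v_ℓ(N_E N_A) ≤ 1` checked, `0`
exceptions, TWO engines (PARI `ellap` via cypari2; ENGINE D pure-Python BSGS/Mestre, identical count, `0` fallbacks);
C2 = `hcertA` (`μ(𝓛₅(A)) = 0`: gen 9 `MU-ALL.tsv`, engines B and C, `λ = 3`; the certified unit coefficient is not the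
constant term); C3 for the partner = `hSchA` (PARI `ellpadicheight` `[v(f),v(g)] = [2,2]`, `v₅(s₂) = 0`, `v₅(f − s₂g)
= 3` + Mazur–Tate σ engine `v₅(h) = 2` (kit j130867); both finite ⇒ the cyclotomic `5`-adic height of `A`'s Cremona
generator is non-zero); `hC3` vacuous (`r_an(E) = 0`). Binders otherwise PUBLISHED (`hKO` … `hGZK`); FINITE `r_an(E) ≤
1`, `r_an(A) ≤ 1`. Per pair; nothing booked; no Jetchev, no descent of the target, no GRH.
[cite: GreenbergVatsal2000, Thm. (1.4) (arXiv p. 5)] [cite: KrausOesterle1992, Prop. 4] [cite: Miller2011LMS, Def. 1.1]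
[cite: Cremona2006, Table 1 (Cremona labels 291312bv1, 41616ck1)] -/
theorem bsdp_t291312bv1_of_bsdp_s41616ck1
    (hKO : KrausOesterle1992.prop4_torsionIso_of_congruences)
    (hBCS : burungale_castella_skinner_charIdeal_eq_padicLFunction)
    (hGr : greenberg_charValue_rankZero) (h5 : realPeriodRat_eq_unit_mul_plusPeriod)
    (hGV : GreenbergVatsal2000.thm14_mainConjecture_transfer_of_torsionIso)
    (hS : Schneider1985_order_charGenerator) (hPR : perrinRiou_rankOne_leadingTerms)
    (hmodP : nonempty_modularParametrizationData) (hmodL : hasEntireLFunction_rat)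
    (hGZK : rank_eq_analyticRank_of_analyticRank_le_one)
    (W A : WeierstrassCurve ℚ) [W.IsElliptic] [W.IsGloballyMinimal] [A.IsElliptic] [A.IsGloballyMinimal]
    [Fact (Nat.Prime 5)]
    (hW : W = ⟨0, 0, 0, -9270831, 10169015834⟩) (hA : A = ⟨0, 0, 0, 204, 799⟩)
    (hran : W.analyticRank ≤ 1) (hrA : A.analyticRank ≤ 1) (hbsdA : BSDp A 5)
    (hSchA : A.analyticRank = 1 → ∀ Dh : PAdicHeightData A 5, Dh.IsCanonical → SchneiderConjecture Dh)
    (hcertA : ∀ [NeZero (A.conductorNorm ℤ)] (fA : CuspForm (Gamma0 (A.conductorNorm ℤ)) 2),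
        IsNewformOf A fA → ∀ (ϖ : ℚ), (ϖ : ℝ) * A.realPeriodRat = plusPeriod fA →
      ∃ n : ℕ, ‖PowerSeries.coeff n
        (PowerSeries.C (ϖ : ℚ_[5]) * padicLFunction fA (unitRoot A 5 : ℚ_[5]))‖ = 1)
    (hcong : ∀ (ℓ : ℕ) [Fact ℓ.Prime],
      6 * ℓ < KrausOesterle1992.gammaZeroIndex (KrausOesterle1992.modulus W A) →
      (padicValNat ℓ (W.conductorNorm ℤ * A.conductorNorm ℤ) = 0 →
          (5 : ℤ) ∣ W.frobeniusTrace ℓ - A.frobeniusTrace ℓ) ∧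
        (padicValNat ℓ (W.conductorNorm ℤ * A.conductorNorm ℤ) = 1 →
          (5 : ℤ) ∣ W.frobeniusTrace ℓ * A.frobeniusTrace ℓ - (ℓ + 1)))
    (hC3 : W.analyticRank = 1 → ∀ Dh : PAdicHeightData W 5, Dh.IsCanonical → SchneiderConjecture Dh) :
    BSDp W 5 := by
  have hIW : integralModelInt W = ⟨0, 0, 0, -9270831, 10169015834⟩ :=
    integralModelInt_eq_of_map_eq _ (by rw [hW]; ext <;> simp [WeierstrassCurve.map])
  have hIA : integralModelInt A = ⟨0, 0, 0, 204, 799⟩ :=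
    integralModelInt_eq_of_map_eq _ (by rw [hA]; ext <;> simp [WeierstrassCurve.map])
  haveI : Fact (Nat.Prime 11) := ⟨by norm_num⟩
  exact bsdp_of_ainvs_of_bsdpPartner_of_congruences_of_analyticRank_le_one hKO hBCS hGr h5 hGV hS hPR hmodP hmodL hGZK
    0 0 0 (-9270831) 10169015834 hIW
    0 0 0 204 799 hIA
    5 11 8 8 8 (by norm_num) (by decide +kernel) card_t291312bv1_5 (by decide) (by decide)
    (by decide +kernel) card_t291312bv1_11 (by decide) (by decide +kernel) card_s41616ck1_5 (by decide)
    hran hrA hbsdA hSchA hcertA hcong hC3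

end Summit.BirchSwinnertonDyer.Rank1Residual.X9

end
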